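import Literature.MathematicalPhysics.KineticTheory.HardSphereEuler
import HarnessLib

/-!
# Smooth imploding solutions of the isentropic compressible Euler equations on `𝕋³`
(Cao-Labora–Gómez-Serrano–Shi–Staffilani 2023/2025)

Topic `Literature/Analysis/FluidPDE`; namespace `Literature.Analysis.FluidPDE`. One NAMED FACT filed
by a grounder for the implosion cluster of the sub-problem `AtomisticToContinuum/HydrodynamicLimit`
(route `ImplosionDichotomy`: support `IdealGasImplosion` = stmt-AtomisticToContinuum-12588, the
σ = 0 input of the cruxes `DenseExcursion` (12586), `PolynomialCompression` (12587) and the glue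
`ImplosionUnboundedDensity` (12590)).

## Source (held text, pages verified by the filing grounder)

G. Cao-Labora, J. Gómez-Serrano, J. Shi, G. Staffilani, *Non-radial implosion for compressible
Euler and Navier–Stokes in `𝕋³` and `ℝ³`*, arXiv:2310.05325 (Camb. J. Math., to appear), bib key
`CaolaboraEtAl2025`:

* eq. (1.1), p. 3: `ρ ∂ₜu + ρ u·∇u = −(1/γ) ∇(ρ^γ) + ν Δu`, `∂ₜρ + div(ρu) = 0`; p. 3: "imploding
  singularities, that is solutions of (1.1) that develop a finite time singularity where both
  `‖u‖_{L^∞}`, `‖ρ‖_{L^∞}` become infinite in finite time";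
* Theorem 1.2, p. 6 (`ν = 1`, torus `𝕋³_L`, `L` large, `T` small): "there exists `C^∞` initial
  data `(u_0, ρ_0)`, with `ρ_0 > 0`, for which equation (1.1) on `𝕋³_L` blows up at time `T` in a
  self-similar manner. More concretely, for any fixed `y ∈ ℝ³`,
  `lim_{t→T⁻} (α⁻¹ r (T−t)^{1−1/r})^{1/α} ρ((T−t)^{1/r} y, t) = S̄(|y|)^{1/α}`" with `S̄ > 0`
  ((1.5), p. 6) and `r > 1` ((1.4), p. 5), so `sup_x ρ(·, t) → ∞` as `t → T⁻`;
* Remark 1.4, p. 6: by scaling "we can generalize Theorem 1.2 for any torus size `2L'` (not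
  necessarily large)";
* Remark 1.5, p. 7: "Both results hold also for the Euler case, `ν = 0`. Moreover, in such a
  case, condition (1.7) is not needed";
* p. 6: "[Buckmaster–Cao-Labora–Gómez-Serrano, arXiv:2208.09445] gives the existence of profiles
  solving (1.3) in the regime (1.4) for all `γ > 1`, including `γ = 5/3`. Moreover, all the
  profiles discussed above satisfy (1.5)–(1.6)" (the hypotheses of Theorem 1.2).

## What is vendored, and the (only) deviations from the printed wording

`CaolaboraEtAl2025_thm12_euler γ` records the COROLLARY of Thm 1.2 + Rem 1.4 + Rem 1.5 + the
quoted profile existence that the hard-sphere routes consume: for the monatomic exponent and, more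
generally, any `γ > 1`, there are a time `T > 0` and a classical (`C^∞` on `[0,T) × 𝕋³`, `ρ > 0`)
solution of the ISENTROPIC Euler system (1.1) with `ν = 0` on the UNIT flat torus
`𝕋³ = UnitAddTorus (Fin 3)` whose density is unbounded on `[0, T)`. Deviations, all weakenings of
the print: (i) the self-similar description of the blow-up and the finite-codimension statement are
dropped (only `sup ρ → ∞`, which they imply since `S̄ > 0`, `r > 1`, is kept, in the `∀ M, ∃ t x`
form); (ii) the torus has period `1` (Rem 1.4: any period); (iii) the equations are written
pointwise in the tree's torus calculus (`Torus.timeDerivWithin` on `[0,T)`, `Torus.partialDeriv`,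
`Torus.gradient`, `Torus.divergence` of `TorusCalculus.lean`), momentum in the printed
NON-conservative form `ρ ∂ₜu + ρ (u·∇)u + ∇(ρ^γ/γ) = 0` with `(u·∇)u = ∑ᵢ uᵢ ∂ᵢu`, and "`C^∞`
data + classical solution up to `T`" as joint smoothness `Torus.IsSmoothSpaceTimeOn (Ico 0 T)`
(the same convention as `Literature.MathematicalPhysics.KineticTheory.IsHardSphereEulerSolution`).
Users take `(h : CaolaboraEtAl2025_thm12_euler (5/3))`; the bridge to the full (non-isentropic)
ideal-gas system `IsHardSphereEulerSolution 0` via `θ := ρ^{γ−1}/γ` is left to provers.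
-/

noncomputable section

open Set

namespace Literature.Analysis.FluidPDE

open Literature.MathematicalPhysics.KineticTheory (T3 V3)

/-- Classical solution of the **isentropic compressible Euler equations** with pressure law
`p(ρ) = ρ^γ/γ` on `[0, T) × 𝕋³` (Cao-Labora–Gómez-Serrano–Shi–Staffilani 2023/2025, eq. (1.1) with
`ν = 0`): `ρ`, `u` jointly `C^∞` on `[0,T) × 𝕋³`, `ρ > 0`, and pointwise (one-sided time
derivative within `[0,T)`) `∂ₜρ + div(ρu) = 0`, `ρ ∂ₜu + ρ ∑ᵢ uᵢ ∂ᵢu + ∇(ρ^γ/γ) = 0`.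
[cite: CaolaboraEtAl2025, eq. (1.1) p. 3 (ν = 0)] -/
structure IsIsentropicEulerSolution (γ T : ℝ) (ρ : ℝ → T3 → ℝ) (u : ℝ → T3 → V3) : Prop where
  smooth_density : Literature.Analysis.FunctionSpaces.Torus.IsSmoothSpaceTimeOn (Ico 0 T) ρ
  smooth_velocity : Literature.Analysis.FunctionSpaces.Torus.IsSmoothSpaceTimeOn (Ico 0 T) u
  density_pos : ∀ t ∈ Ico 0 T, ∀ x, 0 < ρ t x
  mass : ∀ t ∈ Ico 0 T, ∀ x,
    Literature.Analysis.FunctionSpaces.Torus.timeDerivWithin (Ico 0 T) ρ t x +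
      Literature.Analysis.FunctionSpaces.Torus.divergence (fun y => ρ t y • u t y) x = 0
  momentum : ∀ t ∈ Ico 0 T, ∀ x,
    ρ t x • Literature.Analysis.FunctionSpaces.Torus.timeDerivWithin (Ico 0 T) u t x +
      ρ t x • (∑ i, (u t x i) • Literature.Analysis.FunctionSpaces.Torus.partialDeriv i (u t) x) +
      Literature.Analysis.FunctionSpaces.Torus.gradient (fun y => (ρ t y) ^ γ / γ) x = 0

/-- NAMED FACT — **smooth implosion for isentropic compressible Euler on the flat torus**
(Cao-Labora–Gómez-Serrano–Shi–Staffilani, arXiv:2310.05325, Thm 1.2 p. 6 with Rem 1.4 p. 6 (any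
torus size), Rem 1.5 p. 7 (Euler, `ν = 0`) and the profile existence for all `γ > 1` quoted from
Buckmaster–Cao-Labora–Gómez-Serrano on p. 6), in corollary form: for every adiabatic exponent
`γ > 1` there exist `T > 0` and a classical solution `(ρ, u)` of the isentropic Euler system on
`[0, T) × 𝕋³` (so with `C^∞` data `ρ(0) > 0`, `u(0)`) whose density is unbounded on `[0, T)`
("there exists `C^∞` initial data `(u_0, ρ_0)`, with `ρ_0 > 0`, for which equation (1.1) … blows
up at time `T` in a self-similar manner", with `ρ((T−t)^{1/r}y, t) ≍ (T−t)^{−(1−1/r)/α} → ∞`).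
Grounds `Summit.AtomisticToContinuum.HydrodynamicLimit.Theses.ImplosionDichotomy.IdealGasImplosion`
(take `γ = 5/3`). Users take `(h : CaolaboraEtAl2025_thm12_euler γ)`.
[cite: CaolaboraEtAl2025, Thm 1.2 + Rem 1.4 + Rem 1.5] -/
def CaolaboraEtAl2025_thm12_euler (γ : ℝ) : Prop :=
  1 < γ → ∃ T : ℝ, 0 < T ∧ ∃ (ρ : ℝ → T3 → ℝ) (u : ℝ → T3 → V3),
    IsIsentropicEulerSolution γ T ρ u ∧ ∀ M : ℝ, ∃ t ∈ Ico 0 T, ∃ x, M ≤ ρ t x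

end Literature.Analysis.FluidPDE

/-! ## Relocated from `Summits/AtomisticToContinuum/HydrodynamicLimit/Theorems/ImplosionDichotomyDenseExcursionKidderKnob.lean` (gate, accept-time relocation of cited facts) — BuckmasterCaolaboraGomezserrano2025 -/

namespace Literature.Analysis.FluidPDE

open Set Filter Topology
open scoped ContDiff
open Literature.MathematicalPhysics.KineticTheory (V3)

/-- NAMED FACT — **the smooth self-similar implosion profile of the monatomic ideal gas**
(Buckmaster–Cao-Labora–Gómez-Serrano, *Smooth imploding solutions for 3D compressible fluids*, Forum
Math. Pi 13 (2025), arXiv:2208.09445: THEOREM 1.1 at the adiabatic exponent `γ = 5/3`,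
`α = (γ−1)/2 = 1/3`), in corollary form. Printed (§1.2): "Let `γ ∈ (1, +∞)`. There exists
`r^{(3)}(γ) ∈ (r₃(γ), r₄(γ))`, such that there exists a smooth solution to [the autonomous profile
system] starting at `P₀` and ending at `P_∞ = (0, 0)` … This gives a smooth and radially symmetric
self-similar solution to [the radial isentropic Euler equations, `p = ρ^γ/γ`] of the form [of the
self-similar ansatz]." It is written here for the profiles `U(ζ) = (𝒲(ζ) + 𝒵(ζ))/2` (radial
velocity) and `S(ζ) = (𝒲(ζ) − 𝒵(ζ))/2` (rescaled sound speed) of the self-similar variable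
`ζ = R/(T−t)^{1/r}`, where `𝒲, 𝒵` are the paper's `ζ`-profiles of the Riemann invariants
`w = u + σ`, `z = u − σ`, `σ = α⁻¹ρ^α` (§1.3: `w = r⁻¹(T−t)^{1/r−1}𝒲(ζ)`, `z = r⁻¹(T−t)^{1/r−1}𝒵(ζ)`),
so that `u = r⁻¹(T−t)^{1/r−1}U(ζ)`, `σ = r⁻¹(T−t)^{1/r−1}S(ζ)` (the radial profiles `(Ū_R, S̄)` of
the self-similar variables of Cao-Labora–Gómez-Serrano–Shi–Staffilani, arXiv:2310.05325, §1.1); the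
half-sum and half-difference of the two profile equations of §1.3 read
`(r−1)U + (ζ+U)U′ + αSS′ = 0`, `(r−1)S + (ζ+U)S′ + αS(U′ + 2U/ζ) = 0` (`ζ > 0`).
Recorded: (i) the window `r ∈ (r₃(5/3), r₄(5/3))`, with the paper's certified enclosures of
`r₃(γ), r₄(γ)` (Appendix B, Lemmas B.1–B.2 at `1/γ = 3/5`: `r₃(5/3) = 1.101020…`,
`r₄(5/3) = 1.134756…`, radius `1.5·10⁻⁸`) loosened to `1.10102 < r < 1.13476`; (ii) smoothness of
the radial fields `y ↦ U(|y|) y/|y|`, `y ↦ S(|y|)` on `ℝ³` ("smooth and radially symmetric": the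
profile is a convergent power series at `ζ = 0`, extended to `ζ ∈ ℝ` by `𝒵(ζ) = −𝒲(−ζ)` — §1.3 and
Prop. 2.5 — so `U` is odd and `S` even, and it is smooth through the sonic point `P_s`); (iii) the
profile equations for `ζ > 0`; (iv) positivity of `S` on `[0, ∞)` (`S(0) = 𝒲(0) = A > 0`, Prop. 2.5;
the profile lies in the half-plane `W − Z > 0` "for which the density is positive", §1.3 — the
diagonal `W = Z` is invariant for the autonomous `(W, Z)` system and `P₀`, `P_s` lie off it; the
property "`S̄ > 0`" is recorded for these profiles in arXiv:2310.05325, §1.1); (v) the end point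
`P_∞ = (0, 0)`: `W = (U+S)/ζ → 0`, `Z = (U−S)/ζ → 0` as `ζ → ∞`.
Weakenings of the print: `γ = 5/3` only, with the numerical window in place of `(r₃(γ), r₄(γ))`;
the normalisation "`P_s` at `ζ = 1`" and the Taylor data at `P₀`, `P_s` are dropped.
Users take `(h : BuckmasterCaolaboraGomezserrano2025_thm11_monatomic)`.
[cite: BuckmasterCaolaboraGomezserrano2025, Thm 1.1] [file Analysis/FluidPDE/CompressibleEulerImplosion] -/
def BuckmasterCaolaboraGomezserrano2025_thm11_monatomic : Prop :=
  ∃ r : ℝ, 1.10102 < r ∧ r < 1.13476 ∧ ∃ U S : ℝ → ℝ,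
    ContDiff ℝ ∞ (fun y : EuclideanSpace ℝ (Fin 3) => (U ‖y‖ / ‖y‖) • y) ∧
    ContDiff ℝ ∞ (fun y : EuclideanSpace ℝ (Fin 3) => S ‖y‖) ∧
    (∀ ζ : ℝ, 0 < ζ →
      (r - 1) * U ζ + (ζ + U ζ) * deriv U ζ + 1 / 3 * S ζ * deriv S ζ = 0 ∧
      (r - 1) * S ζ + (ζ + U ζ) * deriv S ζ + 1 / 3 * S ζ * (deriv U ζ + 2 * U ζ / ζ) = 0) ∧
    (∀ ζ : ℝ, 0 ≤ ζ → 0 < S ζ) ∧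
    Tendsto (fun ζ => U ζ / ζ) atTop (𝓝 0) ∧ Tendsto (fun ζ => S ζ / ζ) atTop (𝓝 0)
-- TODO(general form): the paper proves this for every `γ > 1` (coefficient `α = (γ−1)/2` in place
-- of `1/3`, window `(r₃(γ), r₄(γ))` defined through `k(r_j) = j`, §1.4 and Lemma 2.1), and for
-- `γ = 7/5` a whole sequence `r^{(n)} ∈ (r_n, r_{n+1})` (Theorem 1.2).

/-! ## Radial profiles seen along a ray -/

/-- The unit vector `e₀ = (1, 0, 0)` of `ℝ³` (local notation `𝐞`). -/
local notation "𝐞" => (EuclideanSpace.single (0 : Fin 3) (1 : ℝ) : V3)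

end Literature.Analysis.FluidPDE
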